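import Mathlib
import HarnessLib
import Summits.HubbardSuperconductivity.HubbardSuperconductivity.Theorems.KLProgrammeKLRegimeSplitTwoLegSizesMSLowMixed

/-!
# Route `KLProgramme`, crux K3 — the `L¹` table of the `2π`-periodic Jackson kernel's derivatives at EVERY order, and the mixed
# Jackson–Bernstein bound at every order (stmt 20437 stub (C): frame-piece jets of order 5–7 for the (B)/(C) doors)

Cell gate-hubbard-kl, seat p2 g11 (plan g17 ruling (α) on question (D), KL STATUS 2026-08-27 l.3040, realised at the Jackson level).  k3c3-p1 g4's
`…JacksonKernelL1` gives `∫|J̃_d^{(a)}| ≤ 4π⁴(d+1)^a` for `a ≤ 3` by hand (closed forms `jkerD1/2/3`), so `…JacksonMixedBernstein.norm_iteratedFDeriv_convInt_le`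
— which needs the product table over ALL splits `a + b + 1 = n` — is usable up to `n = 4` (`…TwoLegSizesMSLowMixed.norm_iteratedFDeriv_convInt_jker_le`).
The frame-response / Jackson-remainder doors of stub (C) read position moments of order `r ≤ 4`, i.e. sampled differences of order `≤ 6`, i.e. frame-piece
jets of order `≤ 6 > 4`.  This file removes the order cap: with `J̃_d = Φ²/(2πc)`, `Φ = Σ_{h≤d} f_h cos(h·)`, `c ≥ 8(d+1)/π⁴`,

* `contDiff_fejerP`, **`iteratedDeriv_fejerP`** — `Φ^{(n)}(s) = Σ_h f_h hⁿ cos(hs + nπ/2)` (every `n`), and the parity forms `…_even/_odd`;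
* **`integral_sq_iteratedDeriv_fejerP_le`** — `∫_{−π}^{π} (Φ^{(n)})² ≤ 8π(d+1)^{2n+1}` (orthogonality + `|f_h| ≤ 2`);
* `abs_iteratedDeriv_jker_le` — Leibniz: `|J̃^{(a)}(s)| ≤ (2πc)⁻¹·Σ_{i≤a} C(a,i)|Φ^{(i)}(s)||Φ^{(a−i)}(s)|`;
* **`integral_abs_iteratedDeriv_jker_le`** — `∫_{−π}^{π}|J̃_d^{(a)}| ≤ (π⁴/2)·2^a·(d+1)^a` for EVERY `a` (weighted AM–GM with `t = (d+1)^{a−i}/(d+1)^i`;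
  at `a = 1, 2, 3` these are k3c3-p1's constants `π⁴, 2π⁴, 4π⁴`); `integral_abs_jkerD_le_all` (the `jkerD` family), `jkerD_table_all`;
* **`norm_iteratedFDeriv_convInt_jker_le_all`** — `‖Dʲ(convInt J̃ J̃ h)(y)‖ ≤ 2ʲ·((π⁸/4)·2^{j−1}·(d+1)^{j−1}·a₁)` for `1 ≤ j ≤ N` whenever the convolution is
  `C^N` and the first partials of `h` are bounded by `a₁` — ONE gradient factor, `j − 1` powers of the degree: for the flow pieces (degree
  `klFlowDeg m = 2^7·4^m`, gradient row `≍ U²·4^{−m}`) this is the `(I-F jets)` law `C_j·U²·4^{(j−2)m}` at every order `j`.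

Proofs only; no definitions; nothing about the model is asserted.  References: BGM 2006 §2.2 (2.23), §2.4 (2.36) [cite: BenfattoGiulianiMastropietro2006];
the kernel facts are classical (Jackson 1911; DeVore–Lorentz, Constructive Approximation, Ch. 7).
-/

noncomputable section

namespace Summit.HubbardSuperconductivity.HubbardSuperconductivity.Theorems.KLRegimeSplit

set_option linter.dupNamespace false -- summit = problem name (single-conjunct summit), D-0017

open Real Finset MeasureTheory intervalIntegral Literature.Analysis.Fourier.TrigApprox
open scoped Nat

/-! ## §1 All derivatives of the Fejér profile `Φ_d = Σ_{h ≤ d} f_h cos(h·)` -/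

/-- `Φ_d` is smooth. -/
theorem contDiff_fejerP (d : ℕ) {n : WithTop ℕ∞} : ContDiff ℝ n (fejerP d) := by
  have h : fejerP d = fun s => ∑ h ∈ range (d + 1), fejerCoeff d h * Real.cos (h * s) := funext (fejerP_eq d)
  rw [h]
  exact ContDiff.sum fun h _ => contDiff_const.mul (Real.contDiff_cos.comp (contDiff_const.mul contDiff_id))

/-- `d/ds [cos(h s + c)] = −h·sin(h s + c) = h·cos(h s + c + π/2)`. -/
theorem hasDerivAt_cos_natMul_add (h : ℕ) (c s : ℝ) :
    HasDerivAt (fun s : ℝ => Real.cos (h * s + c)) ((h : ℝ) * Real.cos (h * s + c + π / 2)) s := by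
  have h1 : HasDerivAt (fun s : ℝ => (h : ℝ) * s + c) (h : ℝ) s := by
    simpa using ((hasDerivAt_id s).const_mul (h : ℝ)).add_const c
  have h2 := h1.cos
  rw [Real.cos_add_pi_div_two]
  convert h2 using 1
  ring

/-- **All derivatives of `Φ_d`**: `Φ^{(n)}(s) = Σ_{h ≤ d} f_h·hⁿ·cos(h s + n·π/2)`. -/
theorem iteratedDeriv_fejerP (d : ℕ) : ∀ n : ℕ,
    iteratedDeriv n (fejerP d) = fun s => ∑ h ∈ range (d + 1), fejerCoeff d h * ((h : ℝ) ^ n * Real.cos (h * s + n * (π / 2)))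
  | 0 => by
    funext s
    rw [iteratedDeriv_zero, fejerP_eq]
    simp
  | n + 1 => by
    rw [iteratedDeriv_succ, iteratedDeriv_fejerP d n]
    funext s
    have hsum : HasDerivAt (fun s => ∑ h ∈ range (d + 1), fejerCoeff d h * ((h : ℝ) ^ n * Real.cos (h * s + n * (π / 2))))
        (∑ h ∈ range (d + 1), fejerCoeff d h * ((h : ℝ) ^ n * ((h : ℝ) * Real.cos (h * s + n * (π / 2) + π / 2)))) s :=
      HasDerivAt.fun_sum fun h _ => ((hasDerivAt_cos_natMul_add h _ s).const_mul _).const_mul _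
    rw [hsum.deriv]
    refine sum_congr rfl fun h _ => ?_
    rw [pow_succ, Nat.cast_succ, add_mul, one_mul, ← add_assoc]
    ring

/-- Even orders: `Φ^{(2m)}(s) = (−1)^m Σ_h (f_h h^{2m}) cos(h s)`. -/
theorem iteratedDeriv_fejerP_even (d m : ℕ) (s : ℝ) :
    iteratedDeriv (2 * m) (fejerP d) s = (-1) ^ m * ∑ h ∈ range (d + 1), (fejerCoeff d h * (h : ℝ) ^ (2 * m)) * Real.cos (h * s) := by
  rw [iteratedDeriv_fejerP, mul_sum]
  refine sum_congr rfl fun h _ => ?_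
  rw [show ((2 * m : ℕ) : ℝ) * (π / 2) = (m : ℕ) * π by push_cast; ring, Real.cos_add_nat_mul_pi]
  ring

/-- Odd orders: `Φ^{(2m+1)}(s) = (−1)^{m+1} Σ_h (f_h h^{2m+1}) sin(h s)`. -/
theorem iteratedDeriv_fejerP_odd (d m : ℕ) (s : ℝ) :
    iteratedDeriv (2 * m + 1) (fejerP d) s = (-1) ^ (m + 1) * ∑ h ∈ range (d + 1), (fejerCoeff d h * (h : ℝ) ^ (2 * m + 1)) * Real.sin (h * s) := by
  rw [iteratedDeriv_fejerP, mul_sum]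
  refine sum_congr rfl fun h _ => ?_
  rw [show ((2 * m + 1 : ℕ) : ℝ) * (π / 2) = π / 2 + (m : ℕ) * π by push_cast; ring, ← add_assoc, Real.cos_add_nat_mul_pi,
    Real.cos_add_pi_div_two, pow_succ]
  ring

/-- **`∫_{−π}^{π} (Φ_d^{(n)})² ≤ 8π(d+1)^{2n+1}`** for every `n`. -/
theorem integral_sq_iteratedDeriv_fejerP_le (d n : ℕ) :
    ∫ s in (-π)..π, iteratedDeriv n (fejerP d) s ^ 2 ≤ 8 * π * ((d : ℝ) + 1) ^ (2 * n + 1) := by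
  have hcoef := sum_sq_fejerCoeff_mul_pow_le d n
  have hπ := Real.pi_pos
  rcases Nat.even_or_odd n with ⟨m, hm⟩ | ⟨m, hm⟩
  · -- even
    have hn : n = 2 * m := by omega
    subst hn
    have h1 : ∀ s, iteratedDeriv (2 * m) (fejerP d) s ^ 2 = (∑ h ∈ range (d + 1), (fejerCoeff d h * (h : ℝ) ^ (2 * m)) * Real.cos (h * s)) ^ 2 := by
      intro s; rw [iteratedDeriv_fejerP_even, mul_pow, ← pow_mul, Even.neg_one_pow (by exact ⟨m, by ring⟩), one_mul]
    simp_rw [h1]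
    refine (integral_sq_cosSum_le (d + 1) (fun h => fejerCoeff d h * (h : ℝ) ^ (2 * m))).trans ?_
    nlinarith [hcoef]
  · -- odd
    subst hm
    have h1 : ∀ s, iteratedDeriv (2 * m + 1) (fejerP d) s ^ 2 =
        (∑ h ∈ range (d + 1), (fejerCoeff d h * (h : ℝ) ^ (2 * m + 1)) * Real.sin (h * s)) ^ 2 := by
      intro s; rw [iteratedDeriv_fejerP_odd, mul_pow, ← pow_mul, Even.neg_one_pow (by exact ⟨m + 1, by ring⟩), one_mul]
    simp_rw [h1]
    refine (integral_sq_sinSum_le (d + 1) (fun h => fejerCoeff d h * (h : ℝ) ^ (2 * m + 1))).trans ?_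
    nlinarith [hcoef]

/-! ## §2 All derivatives of `J̃_d = Φ²/(2πc)`: Leibniz and the `L¹` table -/

/-- Continuity of the derivatives of `Φ_d`. -/
theorem continuous_iteratedDeriv_fejerP (d n : ℕ) : Continuous (iteratedDeriv n (fejerP d)) :=
  ContDiff.continuous_iteratedDeriv' n (contDiff_fejerP d)

/-- `J̃_d = (2πc)⁻¹ · Φ·Φ` as functions. -/
theorem jker_eq_const_mul_sq (d : ℕ) : jker d = fun s => (jacksonConst d * (2 * π))⁻¹ * (fejerP d s * fejerP d s) := by
  funext s; rw [jker_eq_fejerP_sq, sq, div_eq_inv_mul]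

/-- **Leibniz for the kernel**: `|J̃_d^{(a)}(s)| ≤ (2πc)⁻¹·Σ_{i≤a} C(a,i)·|Φ^{(i)}(s)|·|Φ^{(a−i)}(s)|`. -/
theorem abs_iteratedDeriv_jker_le (d a : ℕ) (s : ℝ) :
    |iteratedDeriv a (jker d) s| ≤ (jacksonConst d * (2 * π))⁻¹ *
      ∑ i ∈ range (a + 1), (a.choose i : ℝ) * |iteratedDeriv i (fejerP d) s| * |iteratedDeriv (a - i) (fejerP d) s| := by
  have hc : 0 < jacksonConst d * (2 * π) := jacksonNorm_pos d
  have hΦ : ContDiff ℝ (a : ℕ∞) (fejerP d) := contDiff_fejerP d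
  have hprod : ContDiff ℝ (a : ℕ∞) (fun s => fejerP d s * fejerP d s) := hΦ.mul hΦ
  rw [jker_eq_const_mul_sq, iteratedDeriv_const_mul_field, abs_mul, abs_inv, abs_of_pos hc]
  refine mul_le_mul_of_nonneg_left ?_ (by positivity)
  have h := norm_iteratedFDeriv_mul_le (n := a) hΦ hΦ s (le_refl _)
  simp only [norm_iteratedFDeriv_eq_norm_iteratedDeriv, Real.norm_eq_abs] at h
  have heq : (fun s => fejerP d s * fejerP d s) = fejerP d * fejerP d := rfl
  rw [heq]
  refine h.trans (le_of_eq (sum_congr rfl fun i _ => by ring))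

/-- **THE `L¹` TABLE AT EVERY ORDER**: `∫_{−π}^{π} |J̃_d^{(a)}| ≤ (π⁴/2)·2^a·(d+1)^a`. -/
theorem integral_abs_iteratedDeriv_jker_le (d a : ℕ) :
    ∫ s in (-π)..π, |iteratedDeriv a (jker d) s| ≤ π ^ 4 / 2 * 2 ^ a * ((d : ℝ) + 1) ^ a := by
  have hππ : -π ≤ π := by linarith [Real.pi_pos]
  have hπ := Real.pi_pos
  have hc : 0 < jacksonConst d * (2 * π) := jacksonNorm_pos d
  have hD : (0 : ℝ) < (d : ℝ) + 1 := by positivity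
  set D : ℝ := (d : ℝ) + 1 with hDdef
  -- each Leibniz term integrates to `≤ 8π D^{a+1}`
  have hterm : ∀ i ∈ range (a + 1),
      ∫ s in (-π)..π, (a.choose i : ℝ) * |iteratedDeriv i (fejerP d) s| * |iteratedDeriv (a - i) (fejerP d) s| ≤
        (a.choose i : ℝ) * (8 * π * D ^ (a + 1)) := by
    intro i hi
    have hia : i ≤ a := Nat.lt_succ_iff.mp (mem_range.mp hi)
    obtain ⟨j, rfl⟩ := Nat.exists_eq_add_of_le hia
    rw [Nat.add_sub_cancel_left]
    have hcont : ∀ n, Continuous (iteratedDeriv n (fejerP d)) := continuous_iteratedDeriv_fejerP d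
    simp_rw [mul_assoc]
    rw [intervalIntegral.integral_const_mul]
    refine mul_le_mul_of_nonneg_left ?_ (by positivity)
    have habs : ∀ s, |iteratedDeriv i (fejerP d) s| * |iteratedDeriv j (fejerP d) s| =
        |iteratedDeriv i (fejerP d) s * iteratedDeriv j (fejerP d) s| := fun s => (abs_mul _ _).symm
    simp_rw [habs]
    -- weighted AM–GM with `t = D^j / D^i`
    have ht : 0 < D ^ j / D ^ i := by positivity
    refine (integral_abs_mul_le_amgm (hcont i) (hcont j) ht).trans ?_
    have hi2 := integral_sq_iteratedDeriv_fejerP_le d i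
    have hj2 := integral_sq_iteratedDeriv_fejerP_le d j
    rw [← hDdef] at hi2 hj2
    have hDi : 0 < D ^ i := by positivity
    have hDj : 0 < D ^ j := by positivity
    have e1 : D ^ j / D ^ i * (8 * π * D ^ (2 * i + 1)) = 8 * π * D ^ (i + j + 1) := by
      field_simp
      ring
    have e2 : 8 * π * D ^ (2 * j + 1) / (D ^ j / D ^ i) = 8 * π * D ^ (i + j + 1) := by
      field_simp
      ring
    have h1 : D ^ j / D ^ i * ∫ s in (-π)..π, iteratedDeriv i (fejerP d) s ^ 2 ≤ 8 * π * D ^ (i + j + 1) := by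
      rw [← e1]; exact mul_le_mul_of_nonneg_left hi2 ht.le
    have h2 : (∫ s in (-π)..π, iteratedDeriv j (fejerP d) s ^ 2) / (D ^ j / D ^ i) ≤ 8 * π * D ^ (i + j + 1) := by
      rw [← e2]; exact div_le_div_of_nonneg_right hj2 ht.le
    linarith
  -- sum the Leibniz terms
  calc ∫ s in (-π)..π, |iteratedDeriv a (jker d) s|
      ≤ ∫ s in (-π)..π, (jacksonConst d * (2 * π))⁻¹ *
          ∑ i ∈ range (a + 1), (a.choose i : ℝ) * |iteratedDeriv i (fejerP d) s| * |iteratedDeriv (a - i) (fejerP d) s| := by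
        refine intervalIntegral.integral_mono_on hππ ?_ ?_ fun s _ => abs_iteratedDeriv_jker_le d a s
        · exact (ContDiff.continuous_iteratedDeriv a (contDiff_jker d) (by exact_mod_cast le_top)).abs.intervalIntegrable _ _
        · apply Continuous.intervalIntegrable
          refine continuous_const.mul (continuous_finsetSum _ fun i _ => ?_)
          exact (continuous_const.mul (continuous_iteratedDeriv_fejerP d i).abs).mul (continuous_iteratedDeriv_fejerP d _).abs
    _ = (jacksonConst d * (2 * π))⁻¹ * ∑ i ∈ range (a + 1),
          ∫ s in (-π)..π, (a.choose i : ℝ) * |iteratedDeriv i (fejerP d) s| * |iteratedDeriv (a - i) (fejerP d) s| := by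
        rw [intervalIntegral.integral_const_mul, intervalIntegral.integral_finsetSum]
        intro i _
        apply Continuous.intervalIntegrable
        exact (continuous_const.mul (continuous_iteratedDeriv_fejerP d i).abs).mul (continuous_iteratedDeriv_fejerP d _).abs
    _ ≤ (jacksonConst d * (2 * π))⁻¹ * ∑ i ∈ range (a + 1), (a.choose i : ℝ) * (8 * π * D ^ (a + 1)) :=
        mul_le_mul_of_nonneg_left (sum_le_sum hterm) (by positivity)
    _ = (jacksonConst d * (2 * π))⁻¹ * (2 ^ a * (8 * π * D ^ (a + 1))) := by
        rw [← sum_mul]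
        congr 2
        have h := Nat.sum_range_choose a
        exact_mod_cast h
    _ ≤ π ^ 4 / 2 * 2 ^ a * D ^ a := by
        -- `c ≥ 8(d+1)/π⁴`
        have hcge : 8 * D / π ^ 4 ≤ jacksonConst d := by rw [hDdef]; exact_mod_cast jacksonConst_ge d
        have hcpos := jacksonConst_pos d
        rw [inv_mul_le_iff₀ hc]
        have h4 : 0 < π ^ 4 := by positivity
        have key : 8 * D ≤ jacksonConst d * π ^ 4 := by
          have := (div_le_iff₀ h4).mp hcge
          linarith
        calc 2 ^ a * (8 * π * D ^ (a + 1)) = (8 * D) * (π * 2 ^ a * D ^ a) := by ring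
          _ ≤ (jacksonConst d * π ^ 4) * (π * 2 ^ a * D ^ a) := mul_le_mul_of_nonneg_right key (by positivity)
          _ = jacksonConst d * (2 * π) * (π ^ 4 / 2 * 2 ^ a * D ^ a) := by ring

/-- The `jkerD` family is the iterated derivative. -/
theorem jkerD_eq_iteratedDeriv (d a : ℕ) : jkerD d a = iteratedDeriv a (jker d) := by
  rw [iteratedDeriv_eq_iterate]; rfl

/-- **`∫_{−π}^{π} |jkerD d a| ≤ (π⁴/2)·2^a·(d+1)^a` at every order `a`** (k3c3-p1's `integral_abs_jkerD_le` without the cap `a ≤ 3`). -/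
theorem integral_abs_jkerD_le_all (d a : ℕ) : ∫ s in (-π)..π, |jkerD d a s| ≤ π ^ 4 / 2 * 2 ^ a * ((d : ℝ) + 1) ^ a := by
  rw [jkerD_eq_iteratedDeriv]; exact integral_abs_iteratedDeriv_jker_le d a

/-- **Products**: `(∫|J̃^{(a)}|)(∫|J̃^{(b)}|) ≤ (π⁸/4)·2^{a+b}·(d+1)^{a+b}`. -/
theorem integral_abs_jkerD_mul_le_all (d a b : ℕ) :
    (∫ s in (-π)..π, |jkerD d a s|) * (∫ s in (-π)..π, |jkerD d b s|) ≤ π ^ 8 / 4 * 2 ^ (a + b) * ((d : ℝ) + 1) ^ (a + b) := by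
  have h1 := integral_abs_jkerD_le_all d a
  have h2 := integral_abs_jkerD_le_all d b
  have hππ : -π ≤ π := by linarith [Real.pi_pos]
  have hn2 : 0 ≤ ∫ s in (-π)..π, |jkerD d b s| := intervalIntegral.integral_nonneg hππ fun s _ => abs_nonneg _
  calc (∫ s in (-π)..π, |jkerD d a s|) * (∫ s in (-π)..π, |jkerD d b s|)
      ≤ (π ^ 4 / 2 * 2 ^ a * ((d : ℝ) + 1) ^ a) * (π ^ 4 / 2 * 2 ^ b * ((d : ℝ) + 1) ^ b) := mul_le_mul h1 h2 hn2 (by positivity)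
    _ = π ^ 8 / 4 * 2 ^ (a + b) * ((d : ℝ) + 1) ^ (a + b) := by rw [pow_add, pow_add]; ring

/-- **The kernel product table at every order**: `Λ_n = (π⁸/4)·2^{n−1}·(d+1)^{n−1}`. -/
theorem jkerD_table_all (d n : ℕ) :
    ∀ a b, a + b + 1 = n → (∫ s in (-π)..π, |jkerD d a s|) * (∫ s in (-π)..π, |jkerD d b s|) ≤
      π ^ 8 / 4 * 2 ^ (n - 1) * ((d : ℝ) + 1) ^ (n - 1) := by
  intro a b hab
  have h := integral_abs_jkerD_mul_le_all d a b
  rwa [show a + b = n - 1 by omega] at h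

/-! ## §3 The mixed Jackson–Bernstein bound at every order -/

/-- **Mixed bound for `convInt J̃ J̃ h` at EVERY order**: with `h` lattice-periodic, its first partials bounded by `a₁`, and the convolution of class `C^N`,
`‖Dʲ(convInt J̃_d J̃_d h)(y)‖ ≤ 2ʲ·((π⁸/4)·2^{j−1}·(d+1)^{j−1}·a₁)` for `1 ≤ j ≤ N` — one gradient factor, `j − 1` powers of the degree. -/
theorem norm_iteratedFDeriv_convInt_jker_le_all (d : ℕ) {h h₀ h₁ : (Fin 2 → ℝ) → ℝ} (hh : Continuous h)
    (hper : ∀ (p : Fin 2 → ℝ) (z : Fin 2 → ℤ), h (fun i => p i + z i * (2 * π)) = h p)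
    {N : ℕ} (hJ : ContDiff ℝ N (convInt (jkerD d 0) (jkerD d 0) h)) (hh₀ : Continuous h₀) (hh₁ : Continuous h₁)
    (hder₀ : ∀ s t, HasDerivAt (fun u => h ![u, t]) (h₀ ![s, t]) s) (hder₁ : ∀ s t, HasDerivAt (fun u => h ![s, u]) (h₁ ![s, t]) t)
    {a₁ : ℝ} (hB₀ : ∀ p, |h₀ p| ≤ a₁) (hB₁ : ∀ p, |h₁ p| ≤ a₁) {j : ℕ} (hj1 : 1 ≤ j) (hj : j ≤ N) (y : EuclideanSpace ℝ (Fin 2)) :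
    ‖iteratedFDeriv ℝ j (convInt (jkerD d 0) (jkerD d 0) h) y‖ ≤ 2 ^ j * (π ^ 8 / 4 * 2 ^ (j - 1) * ((d : ℝ) + 1) ^ (j - 1) * a₁) :=
  norm_iteratedFDeriv_convInt_le (hasDerivAt_jkerD d) (continuous_jkerD d) (jkerD_periodic d) hh hper hJ hh₀ hh₁ hder₀ hder₁ hB₀ hB₁
    hj1 hj (jkerD_table_all d j) y

end Summit.HubbardSuperconductivity.HubbardSuperconductivity.Theorems.KLRegimeSplit

end
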